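import Summits.BirchSwinnertonDyer.Rank1Residual.Additive.CycLeadingTermDvd
import Summits.BirchSwinnertonDyer.Rank1Residual.AdditivePotMult.RankZeroChiBranchPrimeFacts
import HarnessLib

/-!
# The LOWER half at an additive (M)/(G-ord) prime, rank `0` — the CONVERSE (Miller currency ⟹ the
# typed `T = 0` divisibility), the iff on the (M) locus, and `BSD(E,p)` on the (M) locus from BOTH
# `T = 0` directions of Delbourgo's Main Conjecture (cell `b2b-bsdres`, team n1011, seat n1011-p18,
# sub-target T-N10b; sequel of `Additive/CycLeadingTermDvd.lean`)

HONEST FRAMING (cell `b2b-bsdres`, run/shared/lean/b2b/bsd-rank1-residual/, verbatim in every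
file): the goal of the cell is to DELETE the COMBINATION-SHAPED residual classes of the
Birch–Swinnerton-Dyer formula for ALL analytic-rank `≤ 1` elliptic curves over `ℚ` — "full BSD
formula for every rank `≤ 1` curve in class `C`" assembled STRICTLY from published theorems — so
that the rank-`≤ 1` remainder becomes exactly the CONSTRUCTION-SHAPED classes, which are TYPED
(missing-input `Prop`s), NOT attempted. This is not "finishing BSD". Team n1011 (RESIDUAL-MAP §I
N10/N11), sub-target T-N10b: research route; no claim beyond the stated classes; N10 stays
CONSTRUCTION / NEEDS; labels unchanged; nothing booked. THEOREMS ONLY (no definition, no named fact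
minted); every published input is an explicit named-fact hypothesis of the tree; no `_holds`.

## What this file proves

`Additive/CycLeadingTermDvd.lean` typed `CycLeadingTermDvdAt W p` — "`L(E,1)/Ω_E` divides the
constant term of EVERY element of `char_Λ X(E/ℚ_∞)`", the MAIN-CONJECTURE direction of Delbourgo's
Main Conjecture (G)/(M) (Compositio 113 (1998) p. 151) at `T = 0` — and proved: that input (+ the
exact rank-zero leading term, a theorem on the (M) locus from Prop. 4 + §2.2 Lemma (ii)) gives the
LOWER half `Typed.MissingLowerBoundAt W p`. Here:

* §1 `cycLeadingTermDvdAt_of_missingLowerBoundAt` — the CONVERSE: for `W` globally minimal, `p ≠ 2`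
  additive of type (G)-ordinary (`TypeGOrd W p`) or (M) (`ord_p j < 0`), `r_an = 0`, `p ∤ c_p(E)`: the
  lower half in Miller's currency + Delbourgo 1998 Prop. 4 in its divisibility transcription
  (`prop4_rankZero_pow_dvd_constantCoeff`: `p^{ord #Ш(p) + ord ∏_{ν≠p} c_ν} ∣ g(0)·#E(ℚ)²` for EVERY
  `g`) + GZK + modularity ⟹ `CycLeadingTermDvdAt W p` (for every `g ∈ char X(E/ℚ_∞)`,
  `ord_p g(0) ≥ ord_p #Ш + ord_p ∏_{ν≠p} c_ν − 2 ord_p #E(ℚ) ≥ ord_p(L(E,1)/Ω_E)`, so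
  `g(0)/(L(E,1)/Ω_E) ∈ ℤ_p`). `p ∤ c_p` is automatic at an additive `p ≥ 5` (Kodaira–Néron
  `c_p ≤ 4`, tree theorem `padicValNat_tamagawaNumberAt_eq_zero_of_addv`); at `p = 3` it is a binder.
* §2 `missingLowerBoundAt_iff_cycLeadingTermDvdAt_of_potMult[_of_five_le]` — on the (M) locus in
  rank `0` (`p ∤ c_p`), **`MissingLowerBoundAt W p ↔ CycLeadingTermDvdAt W p`** granted Prop. 4 in
  both transcriptions (`hDel` divisibility; `hDelX` exactness = Prop. 4 + Lemma (ii)), GZK, modularity: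
  on N10's (M) rows the class-level missing input is, in the kernel, EXACTLY the typed `T = 0`
  divisibility.
* §3 `bsdp_rankZero_of_potMult_of_cycLeadingTerm_of_cycLeadingTermDvd[_of_five_le]` and the class
  forms `ClassX4M.…` / `ClassX3M.…` — on the (M) locus in rank `0`, **`BSD(E,p)` from Delbourgo's Main
  Conjecture AT `T = 0` in BOTH directions**: additive-p2's `CycLeadingTermAt W p` (divisibility
  direction ⟹ the upper half, `missingUpperBoundAt_of_cycLeadingTerm`) ∧ `CycLeadingTermDvdAt W p`
  (main-conjecture direction ⟹ the lower half). NO image, Tamagawa-away-from-`p`, Manin or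
  certificate hypothesis. Both typed inputs are NOT in print at an additive prime; X4(M)/X3♯(M)
  stay CONSTRUCTION-SHAPED; nothing booked.

* §4 END STATE on the (M) locus in rank `0`, Iwasawa currency: seat additive-p1's class theorems
  `ClassX3M.bsdp_rankZero_of_lower` (X3♯(M), ANY odd `p`: upper half from Delbourgo Prop. 4 +
  Wuthrich 2014 Thm. 16 on the `ω^{(p−1)/2}`-component, `hW16`) and
  `ClassX4M.bsdp_rankZero_of_surj_of_lower` (X4(M) ∧ surj(p), ANY odd `p`: Kato on the
  `ω^{(p−1)/2}`-component `hKato`, Wuthrich Lemma 20 `hL20` at `p = 3`) composed with §2 of the first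
  file: **`BSD(E,p)` on X3♯(M) ∧ `r_an = 0` and on X4(M) ∧ surj(p) ∧ `r_an = 0` at EVERY odd `p`
  (`3` included) ⟸ the ONE typed input `CycLeadingTermDvdAt W p`** + published facts
  (`ClassX3M.bsdp_rankZero_of_cycLeadingTermDvd`, `ClassX4M.bsdp_rankZero_of_surj_of_cycLeadingTermDvd`);
  no Tamagawa, Manin, `p ∤ c_p` or certificate binder. At `p = 3` this is the (M)@3 part of
  RESIDUAL-MAP §I N11 (82 103 of the 192 277 surj(3) `r = 0` sweep pairs — number of record, rmap-2):
  there the remaining class-level object is EXACTLY the `T = 0` main-conjecture divisibility for the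
  (M)-measure (equivalently the `ω`-branch of the cyclotomic main conjecture of the multiplicative
  twist `E♭` at `T = 0`), printed nowhere.

References: D. Delbourgo, Compositio Math. 113 (1998) 123–154, §2.2 Lemma (pp. 139–140), Thm. 3
(p. 143), Prop. 4 (p. 144), Main Conjecture (p. 151) [Delbourgo1998]; R. L. Miller, LMS J. Comput.
Math. 14 (2011) Def. 1.1 [Miller2011LMS]; J. H. Silverman, *ATAEC* IV.9.2 (d) (Kodaira–Néron)
[SilvermanATAEC1994]; C. Wuthrich, Doc. Math. 19 (2014) Thm. 16, Lemma 20, Cor. 19 [Wuthrich2014];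
K. Kato, Astérisque 295 (2004) Thm. 17.4 (3) [Kato2004Asterisque].
-/

noncomputable section

open scoped Classical NumberField

open WeierstrassCurve NumberField Literature.NumberTheory.EllipticCurves
  Literature.NumberTheory.EllipticCurves.ModularForms
  Literature.NumberTheory.EllipticCurves.Rank1Residual
  Literature.NumberTheory.EllipticCurves.Rank1Residual.Typed
  IsDedekindDomain Rat.HeightOneSpectrum

namespace Summit.BirchSwinnertonDyer.Rank1Residual.Additive

variable (W : WeierstrassCurve ℚ) [W.IsElliptic] [W.IsGloballyMinimal] (p : ℕ) [hp : Fact p.Prime]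

/-! ### §1 The converse: the lower half in Miller's currency gives back the `T = 0` divisibility (when `p ∤ c_p`) -/

/-- **Converse (rank `0`, additive `p ≠ 2` of type (G)-ordinary or (M), `p ∤ c_p(E)`).** The lower
half `Typed.MissingLowerBoundAt W p` together with Delbourgo 1998 Prop. 4 in its divisibility
transcription (`hDel`: `p^{ord #Ш(p) + ord ∏_{ν≠p} c_ν} ∣ g(0)·#E(ℚ)²` for EVERY `g ∈ char X(E/ℚ_∞)`),
GZK and modularity gives the typed input `CycLeadingTermDvdAt W p`: for every `g`,
`ord_p g(0) ≥ ord_p #Ш + ord_p ∏_{ν≠p} c_ν − 2 ord_p #E(ℚ) ≥ ord_p(L(E,1)/Ω_E) − ord_p c_p`, and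
`ord_p c_p = 0`. [cite: Delbourgo1998, Prop. 4 (p. 144), Main Conjecture (p. 151) (shape)]
[cite: Miller2011LMS, Def. 1.1] -/
theorem cycLeadingTermDvdAt_of_missingLowerBoundAt
    (hDel : Delbourgo1998.prop4_rankZero_pow_dvd_constantCoeff)
    (hGZK : rank_eq_analyticRank_of_analyticRank_le_one) (hmod : hasEntireLFunction_rat)
    (hp2 : p ≠ 2) (hadd : Addv W p) (hGM : TypeGOrd W p ∨ padicValRat p W.j < 0)
    (hr : W.analyticRank = 0)
    (htam : ¬ p ∣ W.tamagawaNumberAt ((primesEquiv (R := 𝓞 ℚ)).symm ⟨p, hp.out⟩))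
    (hlow : MissingLowerBoundAt W p) : CycLeadingTermDvdAt W p := by
  classical
  intro κ γ hκ hγ _hγ' D g hgmem
  have hpP : p.Prime := hp.out
  set v₀ : HeightOneSpectrum (𝓞 ℚ) := (primesEquiv (R := 𝓞 ℚ)).symm ⟨p, hp.out⟩ with hv₀
  -- rank 0: `L(E,1) ≠ 0`, `E(ℚ)` and `Ш` finite
  have hL : W.entireLFunction 1 ≠ 0 := (W.analyticRank_eq_zero_iff_holds (hmod W)).mp hr
  obtain ⟨hmw, hfin⟩ := hGZK W (by rw [hr]; exact zero_le_one)
  have hmw0 : W.mordellWeilRank = 0 := by rw [hmw, hr]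
  haveI : Finite W.sha := hfin
  haveI hE : Finite W.toAffine.Point := W.finite_point_of_rank_zero hmw0
  -- the lower half in Miller's currency: `#Ш_an = q'`, `ord_p q' ≤ ord_p #Ш`
  obtain ⟨q', hq', hle⟩ := hlow
  -- names for the arithmetic quantities
  set T : ℕ := Nat.card W.toAffine.Point with hT
  set c : ℕ := W.tamagawaNumberAt v₀ with hc
  set P' : ℕ := ∏ᶠ v : HeightOneSpectrum (𝓞 ℚ),
    (if (p : 𝓞 ℚ) ∈ v.asIdeal then 1 else W.tamagawaNumberAt v) with hP'
  have hT0 : T ≠ 0 := by rw [hT]; exact Nat.card_pos.ne'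
  have hPsplit : W.tamagawaProduct = c * P' := tamagawaProduct_eq_tamagawaNumberAt_mul_finprod W p
  have hPpos : 0 < W.tamagawaProduct := W.tamagawaProduct_pos_holds
  have hc0 : c ≠ 0 := fun h ↦ by rw [hPsplit, h, zero_mul] at hPpos; exact lt_irrefl 0 hPpos
  have hP'0 : P' ≠ 0 := fun h ↦ by rw [hPsplit, h, mul_zero] at hPpos; exact lt_irrefl 0 hPpos
  have hvc : padicValNat p c = 0 := padicValNat.eq_zero_of_not_dvd htam
  have hvP : padicValNat p W.tamagawaProduct = padicValNat p P' := by
    rw [hPsplit, padicValNat.mul hc0 hP'0, hvc, zero_add]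
  have hsha : padicValNat p (Nat.card (AddCommGroup.primaryComponent W.sha p)) =
      padicValNat p W.shaOrder := by
    unfold WeierstrassCurve.shaOrder
    exact padicValNat_card_addPrimaryComponent p
  -- `q := L(E,1)/Ω_E = q' · ∏ c_ν / T²` is rational
  set q : ℚ := q' * (W.tamagawaProduct : ℚ) / (T : ℚ) ^ 2 with hqdef
  have hΩ : (W.realPeriodRat : ℂ) ≠ 0 := by exact_mod_cast W.realPeriodRat_pos_holds.ne'
  have hTq : (T : ℚ) ≠ 0 := by exact_mod_cast hT0
  have hPq : (W.tamagawaProduct : ℚ) ≠ 0 := by exact_mod_cast hPpos.ne'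
  have hTC : ((T : ℕ) : ℂ) ≠ 0 := by exact_mod_cast hT0
  have hPC : ((W.tamagawaProduct : ℕ) : ℂ) ≠ 0 := by exact_mod_cast hPpos.ne'
  have hLq : W.entireLFunction 1 = (q : ℂ) * (W.realPeriodRat : ℂ) := by
    have h := hq'
    rw [shaAn_def, W.leadingLCoeff_eq_of_analyticRank_eq_zero hr,
      W.regulator_eq_one_of_rank_zero hmw0, Complex.ofReal_one, mul_one,
      W.torsionOrder_eq_natCard_of_finite, ← hT, div_eq_iff (mul_ne_zero hΩ hPC)] at h
    -- `h : L(E,1) · T² = q' · (Ω_E · ∏ c_ν)`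
    rw [hqdef]
    push_cast
    field_simp
    linear_combination h
  have hq0 : q ≠ 0 := by
    intro h0
    apply hL
    rw [hLq, h0, Rat.cast_zero, zero_mul]
  have hq'0 : q' ≠ 0 := by
    intro h0
    apply hq0
    rw [hqdef, h0, zero_mul, zero_div]
  -- `ord_p q = ord_p q' + ord_p P' − 2 ord_p T`
  have hvq : padicValRat p q = padicValRat p q' + padicValNat p P' - 2 * (padicValNat p T : ℤ) := by
    rw [hqdef, padicValRat.div (mul_ne_zero hq'0 hPq) (pow_ne_zero 2 hTq), padicValRat.mul hq'0 hPq,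
      padicValRat.pow, padicValRat.of_nat, padicValRat.of_nat, hvP]
    simp only [Nat.cast_ofNat]
  -- Delbourgo Prop. 4 (divisibility direction) at `g`
  have hGM' := hGM.imp_left (fun hG ↦ hG)
  obtain ⟨-, hdiv⟩ := hDel W p hp2 hadd hGM' hr hfin hE κ γ hκ hγ D
  obtain ⟨c', hc'⟩ := hdiv g hgmem
  set g0 : ℚ_[p] := ((PowerSeries.constantCoeff g : ℤ_[p]) : ℚ_[p]) with hg0def
  have hqQ : ((q : ℚ) : ℚ_[p]) ≠ 0 := by exact_mod_cast hq0
  by_cases hg00 : g0 = 0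
  · -- `g(0) = 0 = 0 · q`
    refine ⟨0, q, hLq, ?_⟩
    rw [hg00, PadicInt.coe_zero, zero_mul]
  · -- `ord_p g(0) + 2 ord_p T ≥ ord_p #Ш + ord_p P'`
    have hTQ : ((T : ℕ) : ℚ_[p]) ≠ 0 := by exact_mod_cast hT0
    have hpQ : (p : ℚ_[p]) ≠ 0 := by exact_mod_cast hpP.ne_zero
    have hkey : g0 * ((T : ℕ) : ℚ_[p]) ^ 2 =
        (p : ℚ_[p]) ^ (padicValNat p (Nat.card (AddCommGroup.primaryComponent W.sha p)) +
          padicValNat p P') * ((c' : ℤ_[p]) : ℚ_[p]) := by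
      have h := congrArg ((↑) : ℤ_[p] → ℚ_[p]) hc'
      push_cast at h
      rw [hg0def]
      exact h
    have hlhs0 : g0 * ((T : ℕ) : ℚ_[p]) ^ 2 ≠ 0 := mul_ne_zero hg00 (pow_ne_zero 2 hTQ)
    have hc'0 : ((c' : ℤ_[p]) : ℚ_[p]) ≠ 0 := by
      intro h0
      rw [h0, mul_zero] at hkey
      exact hlhs0 hkey
    have hval := congrArg Padic.valuation hkey
    rw [Padic.valuation_mul hg00 (pow_ne_zero 2 hTQ), Padic.valuation_pow, Padic.valuation_natCast,
      Padic.valuation_mul (pow_ne_zero _ hpQ) hc'0, Padic.valuation_pow, Padic.valuation_p,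
      mul_one, hsha] at hval
    have hc'val : 0 ≤ (((c' : ℤ_[p]) : ℚ_[p])).valuation := PadicInt.valuation_coe_nonneg
    have hsha' : padicValRat p q' ≤ (padicValNat p W.shaOrder : ℤ) := hle
    -- hence `ord_p q ≤ ord_p g(0)`
    have hvle : padicValRat p q ≤ g0.valuation := by
      simp only [Nat.cast_add, Nat.cast_ofNat] at hval
      rw [hvq]
      linarith
    -- `z := g(0)/q ∈ ℤ_p`
    set x : ℚ_[p] := g0 * ((q : ℚ) : ℚ_[p])⁻¹ with hxdef
    have hx0 : x ≠ 0 := mul_ne_zero hg00 (inv_ne_zero hqQ)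
    have hxq : x * ((q : ℚ) : ℚ_[p]) = g0 := by
      rw [hxdef, inv_mul_cancel_right₀ hqQ]
    have hxval : 0 ≤ x.valuation := by
      have h := congrArg Padic.valuation hxq
      rw [Padic.valuation_mul hx0 hqQ, Padic.valuation_ratCast] at h
      linarith
    refine ⟨⟨x, (Padic.norm_le_one_iff_val_nonneg x).mpr hxval⟩, q, hLq, ?_⟩
    rw [← hxq]

/-! ### §2 The iff on the (M) locus -/

/-- **(M) locus, rank `0`, `p ∤ c_p`: the lower half in Miller's currency and the `T = 0`
main-conjecture divisibility are EQUIVALENT** (granted Delbourgo 1998 Prop. 4 in both directions —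
`hDel` divisibility, `hDelX` exactness on (M) — GZK and modularity). So on N10's (M) rows the
class-level missing input is, in the kernel, EXACTLY `CycLeadingTermDvdAt W p`.
[cite: Delbourgo1998, Prop. 4 (p. 144), §2.2 Lemma (ii) (p. 139), Main Conjecture (p. 151)]
[cite: Miller2011LMS, Def. 1.1] -/
theorem missingLowerBoundAt_iff_cycLeadingTermDvdAt_of_potMult
    (hDel : Delbourgo1998.prop4_rankZero_pow_dvd_constantCoeff)
    (hDelX : Delbourgo1998.prop4_rankZero_constantCoeff_eq_unit_mul_of_potMult)
    (hGZK : rank_eq_analyticRank_of_analyticRank_le_one) (hmod : hasEntireLFunction_rat)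
    (hp2 : p ≠ 2) (hadd : Addv W p) (hj : padicValRat p W.j < 0) (hr : W.analyticRank = 0)
    (htam : ¬ p ∣ W.tamagawaNumberAt ((primesEquiv (R := 𝓞 ℚ)).symm ⟨p, hp.out⟩)) :
    MissingLowerBoundAt W p ↔ CycLeadingTermDvdAt W p :=
  ⟨cycLeadingTermDvdAt_of_missingLowerBoundAt W p hDel hGZK hmod hp2 hadd (Or.inr hj) hr htam,
    missingLowerBoundAt_rankZero_of_potMult_of_cycLeadingTermDvd W p hDelX hGZK hmod hp2 hadd hj hr⟩

/-- **(M) locus, rank `0`, `p ≥ 5`: `MissingLowerBoundAt W p ↔ CycLeadingTermDvdAt W p`** with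
`p ∤ c_p` automatic (Kodaira–Néron `c_p ≤ 4`, tree theorem `padicValNat_tamagawaNumberAt_eq_zero_of_addv`).
[cite: Delbourgo1998, Prop. 4 (p. 144), §2.2 Lemma (ii) (p. 139), Main Conjecture (p. 151)] -/
theorem missingLowerBoundAt_iff_cycLeadingTermDvdAt_of_potMult_of_five_le
    (hDel : Delbourgo1998.prop4_rankZero_pow_dvd_constantCoeff)
    (hDelX : Delbourgo1998.prop4_rankZero_constantCoeff_eq_unit_mul_of_potMult)
    (hGZK : rank_eq_analyticRank_of_analyticRank_le_one) (hmod : hasEntireLFunction_rat)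
    (hp5 : 5 ≤ p) (hadd : Addv W p) (hj : padicValRat p W.j < 0) (hr : W.analyticRank = 0) :
    MissingLowerBoundAt W p ↔ CycLeadingTermDvdAt W p := by
  refine missingLowerBoundAt_iff_cycLeadingTermDvdAt_of_potMult W p hDel hDelX hGZK hmod (by omega)
    hadd hj hr ?_
  have h0 := padicValNat_tamagawaNumberAt_eq_zero_of_addv W p hadd hp5
  obtain ⟨hne, -⟩ := tamagawaNumberAt_ne_zero_and_le_four_of_addv W p hadd
  rcases padicValNat.eq_zero_iff.mp h0 with h1 | h1 | h1
  · exact absurd h1 hp.out.one_lt.ne'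
  · exact absurd h1 hne
  · exact h1

/-! ### §3 Both directions at `T = 0` give `BSD(E,p)` on the (M) locus in rank `0` -/

/-- **(M) locus, rank `0`, `p ∤ c_p`: `BSD(E,p)` from Delbourgo's Main Conjecture AT `T = 0`, BOTH
directions** — `CycLeadingTermAt W p` (divisibility direction: the upper half, additive-p2's
`missingUpperBoundAt_of_cycLeadingTerm`) and `CycLeadingTermDvdAt W p` (main-conjecture direction:
the lower half, `Additive/CycLeadingTermDvd.lean` §2) — with Delbourgo 1998 Prop. 4 in both transcriptions (`hDel`, `hDelX`), GZK and
modularity. NO image, Tamagawa-away-from-`p`, Manin or certificate hypothesis. Both typed inputs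
are NOT in print at an additive prime; X4(M)/X3♯(M) stay CONSTRUCTION-SHAPED; nothing booked.
[cite: Delbourgo1998, Prop. 4 (p. 144), §2.2 Lemma (ii) (p. 139), Main Conjecture (p. 151)]
[cite: Miller2011LMS, Def. 1.1] -/
theorem bsdp_rankZero_of_potMult_of_cycLeadingTerm_of_cycLeadingTermDvd
    (hDel : Delbourgo1998.prop4_rankZero_pow_dvd_constantCoeff)
    (hDelX : Delbourgo1998.prop4_rankZero_constantCoeff_eq_unit_mul_of_potMult)
    (hGZK : rank_eq_analyticRank_of_analyticRank_le_one) (hmod : hasEntireLFunction_rat)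
    (hp2 : p ≠ 2) (hadd : Addv W p) (hj : padicValRat p W.j < 0) (hr : W.analyticRank = 0)
    (htam : ¬ p ∣ W.tamagawaNumberAt ((primesEquiv (R := 𝓞 ℚ)).symm ⟨p, hp.out⟩))
    (hLT : CycLeadingTermAt W p) (hDvd : CycLeadingTermDvdAt W p) : BSDp W p :=
  bsdp_of_missingPPartAt W p hGZK (by rw [hr]; exact zero_le_one)
    (missingPPartAt_of_lower_of_upper W p
      (missingLowerBoundAt_rankZero_of_potMult_of_cycLeadingTermDvd W p hDelX hGZK hmod hp2 hadd hj
        hr hDvd)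
      (missingUpperBoundAt_of_cycLeadingTerm W p hDel hGZK hmod hp2 hadd (Or.inr hj) hr hLT htam))

/-- **(M) locus, rank `0`, `p ≥ 5`: `BSD(E,p)` from both `T = 0` directions**, `p ∤ c_p` automatic.
[cite: Delbourgo1998, Prop. 4 (p. 144), §2.2 Lemma (ii) (p. 139), Main Conjecture (p. 151)] -/
theorem bsdp_rankZero_of_potMult_of_cycLeadingTerm_of_cycLeadingTermDvd_of_five_le
    (hDel : Delbourgo1998.prop4_rankZero_pow_dvd_constantCoeff)
    (hDelX : Delbourgo1998.prop4_rankZero_constantCoeff_eq_unit_mul_of_potMult)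
    (hGZK : rank_eq_analyticRank_of_analyticRank_le_one) (hmod : hasEntireLFunction_rat)
    (hp5 : 5 ≤ p) (hadd : Addv W p) (hj : padicValRat p W.j < 0) (hr : W.analyticRank = 0)
    (hLT : CycLeadingTermAt W p) (hDvd : CycLeadingTermDvdAt W p) : BSDp W p :=
  bsdp_of_missingPPartAt W p hGZK (by rw [hr]; exact zero_le_one)
    (missingPPartAt_of_lower_of_upper W p
      (missingLowerBoundAt_rankZero_of_potMult_of_cycLeadingTermDvd W p hDelX hGZK hmod (by omega)
        hadd hj hr hDvd)
      (missingUpperBoundAt_of_cycLeadingTerm_of_five_le W p hDel hGZK hmod hp5 hadd (Or.inr hj) hr hLT))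

variable {W p}

/-- **X4(M), `r_an = 0`, `p ∤ c_p`: `BSD(E,p)` from both `T = 0` directions of Delbourgo's Main
Conjecture** (class form). [cite: Delbourgo1998, Prop. 4 (p. 144), §2.2 Lemma (ii) (p. 139), Main Conjecture (p. 151)] -/
theorem _root_.Summit.BirchSwinnertonDyer.Rank1Residual.AdditivePotMult.ClassX4M.bsdp_rankZero_of_cycLeadingTerm_of_cycLeadingTermDvd
    (hDel : Delbourgo1998.prop4_rankZero_pow_dvd_constantCoeff)
    (hDelX : Delbourgo1998.prop4_rankZero_constantCoeff_eq_unit_mul_of_potMult)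
    (hGZK : rank_eq_analyticRank_of_analyticRank_le_one) (hmod : hasEntireLFunction_rat)
    (hX : AdditivePotMult.ClassX4M W p) (hr : W.analyticRank = 0)
    (htam : ¬ p ∣ W.tamagawaNumberAt ((primesEquiv (R := 𝓞 ℚ)).symm ⟨p, hp.out⟩))
    (hLT : CycLeadingTermAt W p) (hDvd : CycLeadingTermDvdAt W p) : BSDp W p :=
  bsdp_rankZero_of_potMult_of_cycLeadingTerm_of_cycLeadingTermDvd W p hDel hDelX hGZK hmod hX.1.1
    hX.2.1 hX.2.2 hr htam hLT hDvd

/-- **X3♯(M), `r_an = 0`, `p ∤ c_p`: `BSD(E,p)` from both `T = 0` directions** (class form; no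
image hypothesis anywhere). [cite: Delbourgo1998, Prop. 4 (p. 144), §2.2 Lemma (ii) (p. 139), Main Conjecture (p. 151)] -/
theorem _root_.Summit.BirchSwinnertonDyer.Rank1Residual.AdditivePotMult.ClassX3M.bsdp_rankZero_of_cycLeadingTerm_of_cycLeadingTermDvd
    (hDel : Delbourgo1998.prop4_rankZero_pow_dvd_constantCoeff)
    (hDelX : Delbourgo1998.prop4_rankZero_constantCoeff_eq_unit_mul_of_potMult)
    (hGZK : rank_eq_analyticRank_of_analyticRank_le_one) (hmod : hasEntireLFunction_rat)
    (hX : AdditivePotMult.ClassX3M W p) (hr : W.analyticRank = 0)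
    (htam : ¬ p ∣ W.tamagawaNumberAt ((primesEquiv (R := 𝓞 ℚ)).symm ⟨p, hp.out⟩))
    (hLT : CycLeadingTermAt W p) (hDvd : CycLeadingTermDvdAt W p) : BSDp W p :=
  bsdp_rankZero_of_potMult_of_cycLeadingTerm_of_cycLeadingTermDvd W p hDel hDelX hGZK hmod hX.2.2
    hX.2.1.1 hX.2.1.2 hr htam hLT hDvd

/-! ### §4 END STATE on the (M) locus, rank `0`: `BSD(E,p)` from the ONE typed input `CycLeadingTermDvdAt` + published facts -/

/-- **X3♯(M) ∧ `r_an = 0`, ANY odd `p` (`3` included): `BSD(E,p)` ⟸ the typed `T = 0`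
main-conjecture divisibility `CycLeadingTermDvdAt W p`** + published facts: the LOWER half from
`CycLeadingTermDvdAt` (Delbourgo Prop. 4 + Lemma (ii) exact, `hDelX`), the UPPER half being seat
additive-p1's `ClassX3M.missingUpperBoundAt_rankZero` (Delbourgo Prop. 4 `hDel`, Wuthrich 2014 Thm. 16
on the `ω^{(p−1)/2}`-component `hW16`, `hmodD`, GZK, modularity). No image, Tamagawa, Manin,
`p ∤ c_p` or certificate binder. X3♯(M) stays CONSTRUCTION-SHAPED (the input is printed nowhere);
nothing booked. [cite: Delbourgo1998, Prop. 4 (p. 144), §2.2 Lemma (ii) (p. 139), Main Conjecture (p. 151)]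
[cite: Wuthrich2014, Thm. 16 (p. 397)] -/
theorem _root_.Summit.BirchSwinnertonDyer.Rank1Residual.AdditivePotMult.ClassX3M.bsdp_rankZero_of_cycLeadingTermDvd
    (hDel : Delbourgo1998.prop4_rankZero_pow_dvd_constantCoeff)
    (hDelX : Delbourgo1998.prop4_rankZero_constantCoeff_eq_unit_mul_of_potMult)
    (hGZK : rank_eq_analyticRank_of_analyticRank_le_one) (hmod : hasEntireLFunction_rat)
    (hmodD : nonempty_modularParametrizationData)
    (hW16 : Wuthrich2014.thm16_halfEigenCharIdeal_dvd_cyclotomicPrime)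
    (hX : AdditivePotMult.ClassX3M W p) (hr : W.analyticRank = 0) (hDvd : CycLeadingTermDvdAt W p) :
    BSDp W p :=
  AdditivePotMult.ClassX3M.bsdp_rankZero_of_lower hDel hGZK hmod hmodD hW16 hX hr
    (AdditivePotMult.ClassX3M.missingLowerBoundAt_rankZero_of_cycLeadingTermDvd hDelX hGZK hmod hX hr
      hDvd)

/-- **X4(M) ∧ surj(p) ∧ `r_an = 0`, ANY odd `p` (`3` included): `BSD(E,p)` ⟸ the typed `T = 0`
main-conjecture divisibility `CycLeadingTermDvdAt W p`** + published facts: the LOWER half from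
`CycLeadingTermDvdAt` (`hDelX`), the UPPER half being seat additive-p1's
`ClassX4M.missingUpperBoundAt_rankZero_of_surj` (Delbourgo Prop. 4 `hDel`, Kato's divisibility on the
`ω^{(p−1)/2}`-component `hKato`, Wuthrich Lemma 20 `hL20` for the `3`-adic image of the multiplicative
twist at `p = 3`, `hmodD`, GZK, modularity). No Tamagawa, Manin, `p ∤ c_p`, `j`-witness or
certificate binder. At `p = 3` this is the (M)@3 part of RESIDUAL-MAP §I N11. X4(M) stays
CONSTRUCTION-SHAPED; nothing booked. [cite: Delbourgo1998, Prop. 4 (p. 144), §2.2 Lemma (ii) (p. 139), Main Conjecture (p. 151)]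
[cite: Wuthrich2014, Lemma 20 (p. 399), Cor. 19 (p. 398)] [cite: Kato2004Asterisque, Thm. 17.4 (3) (p. 273)] -/
theorem _root_.Summit.BirchSwinnertonDyer.Rank1Residual.AdditivePotMult.ClassX4M.bsdp_rankZero_of_surj_of_cycLeadingTermDvd
    (hDel : Delbourgo1998.prop4_rankZero_pow_dvd_constantCoeff)
    (hDelX : Delbourgo1998.prop4_rankZero_constantCoeff_eq_unit_mul_of_potMult)
    (hGZK : rank_eq_analyticRank_of_analyticRank_le_one) (hmod : hasEntireLFunction_rat)
    (hmodD : nonempty_modularParametrizationData)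
    (hL20 : Wuthrich2014.lemma20_surjective_threeAdic_of_semistable)
    (hKato : Wuthrich2014.kato_halfEigenCharIdeal_dvd_cyclotomicPrime_of_surjective)
    (hX : AdditivePotMult.ClassX4M W p) (hr : W.analyticRank = 0) (hsurj : Surj W p)
    (hDvd : CycLeadingTermDvdAt W p) : BSDp W p :=
  AdditivePotMult.ClassX4M.bsdp_rankZero_of_surj_of_lower hDel hGZK hmod hmodD hL20 hKato hX hr hsurj
    (AdditivePotMult.ClassX4M.missingLowerBoundAt_rankZero_of_cycLeadingTermDvd hDelX hGZK hmod hX hr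
      hDvd)

/-- **X4(M) ∧ surj(p) ∧ `r_an = 0`, ANY odd `p`: what remains of X4♯ is EXACTLY the typed `T = 0`
divisibility** — `Typed.X4.MissingInputAt W p ↔ CycLeadingTermDvdAt W p` when `p ∤ c_p(E)` (granted
the published facts of `ClassX4M.missingInputAt_iff_lower_rankZero_of_surj` and Prop. 4 both ways).
[cite: Delbourgo1998, Prop. 4 (p. 144), §2.2 Lemma (ii) (p. 139), Main Conjecture (p. 151)]
[cite: Wuthrich2014, Lemma 20 (p. 399), Cor. 19 (p. 398)] -/
theorem _root_.Summit.BirchSwinnertonDyer.Rank1Residual.AdditivePotMult.ClassX4M.missingInputAt_iff_cycLeadingTermDvdAt_rankZero_of_surj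
    (hDel : Delbourgo1998.prop4_rankZero_pow_dvd_constantCoeff)
    (hDelX : Delbourgo1998.prop4_rankZero_constantCoeff_eq_unit_mul_of_potMult)
    (hGZK : rank_eq_analyticRank_of_analyticRank_le_one) (hmod : hasEntireLFunction_rat)
    (hmodD : nonempty_modularParametrizationData)
    (hL20 : Wuthrich2014.lemma20_surjective_threeAdic_of_semistable)
    (hKato : Wuthrich2014.kato_halfEigenCharIdeal_dvd_cyclotomicPrime_of_surjective)
    (hX : AdditivePotMult.ClassX4M W p) (hr : W.analyticRank = 0) (hsurj : Surj W p)
    (htam : ¬ p ∣ W.tamagawaNumberAt ((primesEquiv (R := 𝓞 ℚ)).symm ⟨p, hp.out⟩)) :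
    X4.MissingInputAt W p ↔ CycLeadingTermDvdAt W p :=
  (AdditivePotMult.ClassX4M.missingInputAt_iff_lower_rankZero_of_surj hDel hGZK hmod hmodD hL20 hKato
      hX hr hsurj).trans
    (missingLowerBoundAt_iff_cycLeadingTermDvdAt_of_potMult W p hDel hDelX hGZK hmod hX.1.1 hX.2.1
      hX.2.2 hr htam)

/-- **X3♯(M) ∧ `r_an = 0`, ANY odd `p`: what remains of X3♯ is EXACTLY the typed `T = 0`
divisibility** — `Typed.X3.MissingInputAt W p ↔ CycLeadingTermDvdAt W p` when `p ∤ c_p(E)`.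
[cite: Delbourgo1998, Prop. 4 (p. 144), §2.2 Lemma (ii) (p. 139), Main Conjecture (p. 151)]
[cite: Wuthrich2014, Thm. 16 (p. 397)] -/
theorem _root_.Summit.BirchSwinnertonDyer.Rank1Residual.AdditivePotMult.ClassX3M.missingInputAt_iff_cycLeadingTermDvdAt_rankZero
    (hDel : Delbourgo1998.prop4_rankZero_pow_dvd_constantCoeff)
    (hDelX : Delbourgo1998.prop4_rankZero_constantCoeff_eq_unit_mul_of_potMult)
    (hGZK : rank_eq_analyticRank_of_analyticRank_le_one) (hmod : hasEntireLFunction_rat)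
    (hmodD : nonempty_modularParametrizationData)
    (hW16 : Wuthrich2014.thm16_halfEigenCharIdeal_dvd_cyclotomicPrime)
    (hX : AdditivePotMult.ClassX3M W p) (hr : W.analyticRank = 0)
    (htam : ¬ p ∣ W.tamagawaNumberAt ((primesEquiv (R := 𝓞 ℚ)).symm ⟨p, hp.out⟩)) :
    X3.MissingInputAt W p ↔ CycLeadingTermDvdAt W p :=
  (AdditivePotMult.ClassX3M.missingInputAt_iff_lower_rankZero hDel hGZK hmod hmodD hW16 hX hr).trans
    (missingLowerBoundAt_iff_cycLeadingTermDvdAt_of_potMult W p hDel hDelX hGZK hmod hX.2.2 hX.2.1.1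
      hX.2.1.2 hr htam)

end Summit.BirchSwinnertonDyer.Rank1Residual.Additive

end
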